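import Mathlib
import Summits.ResolutionOfSingularities.ResolutionOfSingularities.Theorems.RadicialJungCleanModelsCleanLU3Defectless
import HarnessLib

/-!
# Route `RadicialJung`, crux `CleanModels` (stmt-15917), stub `stub_cleanLU3`: the CLEANING STEP along a valuation and
# clean local uniformization whenever `p`-th-power approximation of `g₀` cannot be improved forever

Line `Sketch` (rev 16 → 17) of crux stmt-ResolutionOfSingularities-15917; lead `res-B-lead-1` g2.  OURS; nothing here proves resolution
in characteristic `p`.  Everything is modulo embedded resolution of surfaces in regular excellent schemes (`hEmb`, Cossart–Jannsen–Saito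
2020 Cor. 1.5, the hypothesis shape of `Literature/…/MonomializationAlongValuation.lean`).

* `cleanLU3_or_exists_lt` — THE CLEANING STEP: for every `f₀ ∈ K`, either the conclusion of `stub_cleanLU3` holds at `O`, or some
  `f₁` approximates `g₀` STRICTLY better than `f₀` (`v (g₀ - f₁^p) < v (g₀ - f₀^p)`).  (Excluded middle on ✓ `cleanLU3_of_isMin_pthPowerApprox`:
  monomialize `g₀ - f₀^p` along `v`; an exponent prime to `p`, a residually new unit or a unit `≡ c^p (mod 𝔪 ∖ 𝔪²)` is clean, and the
  remaining case `u ≡ c^p (mod 𝔪²)` produces the better approximation.)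
* `cleanLU3_of_wellFounded_approx` — hence clean local uniformization at every valuation along which strict improvement of
  `p`-th-power approximations of `g₀` is WELL-FOUNDED (no infinite strictly improving sequence `f₀, f₁, …`), e.g. discrete rank-one
  valuations at which `g₀` is not a limit of `p`-th powers.  The research residue of `stub_cleanLU3` is thereby located: valuations
  carrying an infinite strictly improving sequence of `p`-th-power approximations of (every non-trivial element of the line of) `g₀`.
-/

noncomputable section

set_option linter.dupNamespace false -- mandated namespace of this single-conjunct summit

open IsLocalRing AlgebraicGeometry CategoryTheory
open Literature.AlgebraicGeometry.Resolution

namespace Summit.ResolutionOfSingularities.ResolutionOfSingularities.Theorems.RadicialJung.CleanModels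

/-- **The cleaning step along a valuation** (modulo CJS Cor. 1.5): for every `f₀`, either clean local uniformization of the line of
`g₀` holds at `O` (conclusion of `stub_cleanLU3`), or `g₀` has a strictly better `p`-th-power approximation than `f₀`.
[cite: CossartJannsenSaito2020, Cor. 1.5, p. 7] -/
theorem cleanLU3_or_exists_lt
    (hEmb : ∀ (Z : Scheme.{0}) [IsIntegral Z] [IsNoetherian Z], Scheme.IsRegular Z →
      Scheme.IsExcellent Z → ∀ (X : Set Z), IsClosed X → X ≠ Set.univ → topologicalKrullDim X ≤ 2 →
        ∃ (Z' : Scheme.{0}) (π : Z' ⟶ Z), IsProper π ∧ Function.Surjective π.base ∧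
          (∃ U : Z.Opens, (U : Set Z) = Xᶜ ∧ IsIso (π ∣_ U)) ∧
          IsStrictNormalCrossingsDivisor Z' (π.base ⁻¹' X))
    (p : ℕ) (hp : p.Prime) (k : Type) [Field k] [CharP k p] (K : Type) [Field K] [Algebra k K]
    (O : ValuationSubring K) (A : Subalgebra k K) (hAO : A.toSubring ≤ O.toSubring) (hAfg : A.FG)
    (hfrac : IsFractionRing A K)
    (hreg : IsRegularLocalRing (locAtCentre A.toSubring O))
    (hdim3 : ringKrullDim (locAtCentre A.toSubring O) = 3)
    (g₀ : K) (hg₀ : ∀ c : K, c ^ p ≠ g₀) (f₀ : K) :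
    (∃ (A' : Subalgebra k K), A'.toSubring ≤ O.toSubring ∧ A ≤ A' ∧ A'.FG ∧
      ∃ (_ : IsRegularLocalRing (locAtCentre A'.toSubring O)) (c : Fin p → K),
        (∃ j : Fin p, (j : ℕ) ≠ 0 ∧ c j ≠ 0) ∧
        ((∃ (d m : ℕ) (hmd : m ≤ d) (t : Fin d → ↥(locAtCentre A'.toSubring O)) (a : Fin m → ℕ)
            (u : ↥(locAtCentre A'.toSubring O)), IsUnit u ∧
            Ideal.span (Set.range t) = IsLocalRing.maximalIdeal ↥(locAtCentre A'.toSubring O) ∧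
            ringKrullDim ↥(locAtCentre A'.toSubring O) = (d : WithBot ℕ∞) ∧ 0 < m ∧ (∀ i, ¬ p ∣ a i) ∧
            (∑ j : Fin p, c j ^ p * g₀ ^ (j : ℕ)) =
              (u : K) * ∏ i : Fin m, ((t (Fin.castLE hmd i) : ↥(locAtCentre A'.toSubring O)) : K) ^ (a i)) ∨
          (∃ u : ↥(locAtCentre A'.toSubring O), IsUnit u ∧ (∑ j : Fin p, c j ^ p * g₀ ^ (j : ℕ)) = (u : K) ∧
            ∀ c' : ↥(locAtCentre A'.toSubring O), u - c' ^ p ∉ IsLocalRing.maximalIdeal ↥(locAtCentre A'.toSubring O)) ∨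
          (∃ s c' : ↥(locAtCentre A'.toSubring O), (∑ j : Fin p, c j ^ p * g₀ ^ (j : ℕ)) = (s : K) ∧
            s - c' ^ p ∈ IsLocalRing.maximalIdeal ↥(locAtCentre A'.toSubring O) ∧
            s - c' ^ p ∉ IsLocalRing.maximalIdeal ↥(locAtCentre A'.toSubring O) ^ 2))) ∨
    ∃ f₁ : K, O.valuation (g₀ - f₁ ^ p) < O.valuation (g₀ - f₀ ^ p) := by
  by_cases hmin : ∀ f : K, O.valuation (g₀ - f₀ ^ p) ≤ O.valuation (g₀ - f ^ p)
  · exact Or.inl (cleanLU3_of_isMin_pthPowerApprox hEmb p hp k K O A hAO hAfg hfrac hreg hdim3 g₀ hg₀ f₀ hmin)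
  · push Not at hmin
    exact Or.inr hmin

/-- **Clean local uniformization whenever `p`-th-power approximation of `g₀` cannot be improved forever** (modulo CJS Cor. 1.5):
if the relation «`f₁` approximates `g₀` strictly better than `f₀`» on `K` is well-founded for the valuation of `O`, the conclusion
of `stub_cleanLU3` holds at `O` (iterate the cleaning step `cleanLU3_or_exists_lt`). [cite: CossartJannsenSaito2020, Cor. 1.5, p. 7] -/
theorem cleanLU3_of_wellFounded_approx
    (hEmb : ∀ (Z : Scheme.{0}) [IsIntegral Z] [IsNoetherian Z], Scheme.IsRegular Z →
      Scheme.IsExcellent Z → ∀ (X : Set Z), IsClosed X → X ≠ Set.univ → topologicalKrullDim X ≤ 2 →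
        ∃ (Z' : Scheme.{0}) (π : Z' ⟶ Z), IsProper π ∧ Function.Surjective π.base ∧
          (∃ U : Z.Opens, (U : Set Z) = Xᶜ ∧ IsIso (π ∣_ U)) ∧
          IsStrictNormalCrossingsDivisor Z' (π.base ⁻¹' X))
    (p : ℕ) (hp : p.Prime) (k : Type) [Field k] [CharP k p] (K : Type) [Field K] [Algebra k K]
    (O : ValuationSubring K) (A : Subalgebra k K) (hAO : A.toSubring ≤ O.toSubring) (hAfg : A.FG)
    (hfrac : IsFractionRing A K)
    (hreg : IsRegularLocalRing (locAtCentre A.toSubring O))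
    (hdim3 : ringKrullDim (locAtCentre A.toSubring O) = 3)
    (g₀ : K) (hg₀ : ∀ c : K, c ^ p ≠ g₀)
    (hwf : WellFounded fun f₁ f₀ : K => O.valuation (g₀ - f₁ ^ p) < O.valuation (g₀ - f₀ ^ p)) :
    ∃ (A' : Subalgebra k K), A'.toSubring ≤ O.toSubring ∧ A ≤ A' ∧ A'.FG ∧
      ∃ (_ : IsRegularLocalRing (locAtCentre A'.toSubring O)) (c : Fin p → K),
        (∃ j : Fin p, (j : ℕ) ≠ 0 ∧ c j ≠ 0) ∧
        ((∃ (d m : ℕ) (hmd : m ≤ d) (t : Fin d → ↥(locAtCentre A'.toSubring O)) (a : Fin m → ℕ)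
            (u : ↥(locAtCentre A'.toSubring O)), IsUnit u ∧
            Ideal.span (Set.range t) = IsLocalRing.maximalIdeal ↥(locAtCentre A'.toSubring O) ∧
            ringKrullDim ↥(locAtCentre A'.toSubring O) = (d : WithBot ℕ∞) ∧ 0 < m ∧ (∀ i, ¬ p ∣ a i) ∧
            (∑ j : Fin p, c j ^ p * g₀ ^ (j : ℕ)) =
              (u : K) * ∏ i : Fin m, ((t (Fin.castLE hmd i) : ↥(locAtCentre A'.toSubring O)) : K) ^ (a i)) ∨
          (∃ u : ↥(locAtCentre A'.toSubring O), IsUnit u ∧ (∑ j : Fin p, c j ^ p * g₀ ^ (j : ℕ)) = (u : K) ∧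
            ∀ c' : ↥(locAtCentre A'.toSubring O), u - c' ^ p ∉ IsLocalRing.maximalIdeal ↥(locAtCentre A'.toSubring O)) ∨
          (∃ s c' : ↥(locAtCentre A'.toSubring O), (∑ j : Fin p, c j ^ p * g₀ ^ (j : ℕ)) = (s : K) ∧
            s - c' ^ p ∈ IsLocalRing.maximalIdeal ↥(locAtCentre A'.toSubring O) ∧
            s - c' ^ p ∉ IsLocalRing.maximalIdeal ↥(locAtCentre A'.toSubring O) ^ 2)) := by
  -- well-founded induction on `f₀`, starting anywhere (at `0`)
  suffices h : ∀ f₀ : K, _ from h 0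
  intro f₀
  induction f₀ using hwf.induction with
  | _ f₀ ih =>
    rcases cleanLU3_or_exists_lt hEmb p hp k K O A hAO hAfg hfrac hreg hdim3 g₀ hg₀ f₀ with h | ⟨f₁, hf₁⟩
    · exact h
    · exact ih f₁ hf₁

/-! ## Discrete rank one: bounded approximability is well-founded -/

/-- **Discrete step, bounded below ⟹ well-founded.** If every strict inequality of values costs at least a factor `v π`
(`v x < v y → v x ≤ v π · v y`), powers of `v π` eventually push any value below any nonzero value (rank one), and the values
`v (g₀ - f^p)` are bounded below by `v b`, `b ≠ 0` (`g₀` is not a limit of `p`-th powers), then strict improvement of `p`-th-power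
approximations of `g₀` is well-founded. [folklore] -/
theorem wellFounded_approx_of_discrete {K : Type} [Field K] {p : ℕ} (O : ValuationSubring K) (g₀ π b : K) (hb : b ≠ 0)
    (hstep : ∀ x y : K, O.valuation x < O.valuation y → O.valuation x ≤ O.valuation π * O.valuation y)
    (harch : ∀ x y : K, x ≠ 0 → ∃ n : ℕ, O.valuation π ^ n * O.valuation y ≤ O.valuation x)
    (hbound : ∀ f : K, O.valuation b ≤ O.valuation (g₀ - f ^ p)) :
    WellFounded fun f₁ f₀ : K => O.valuation (g₀ - f₁ ^ p) < O.valuation (g₀ - f₀ ^ p) := by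
  classical
  -- the measure: the least `n` with `v π ^ n · v (g₀ - f^p) ≤ v b`
  let μ : K → ℕ := fun f => Nat.find (harch b (g₀ - f ^ p) hb)
  have hμ : ∀ f, O.valuation π ^ μ f * O.valuation (g₀ - f ^ p) ≤ O.valuation b := fun f =>
    Nat.find_spec (harch b (g₀ - f ^ p) hb)
  have hμmin : ∀ f n, O.valuation π ^ n * O.valuation (g₀ - f ^ p) ≤ O.valuation b → μ f ≤ n := fun f n hn =>
    Nat.find_min' (harch b (g₀ - f ^ p) hb) hn
  refine Subrelation.wf (r := InvImage (· < ·) μ) ?_ (InvImage.wf μ wellFounded_lt)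
  intro f₁ f₀ hlt
  change μ f₁ < μ f₀
  have h0 : μ f₀ ≠ 0 := by
    intro h0
    have h1 := hμ f₀
    rw [h0, pow_zero, one_mul] at h1
    exact absurd ((hbound f₁).trans_lt hlt) (not_lt.mpr h1)
  obtain ⟨n, hn⟩ := Nat.exists_eq_succ_of_ne_zero h0
  have hle : μ f₁ ≤ n := by
    refine hμmin f₁ n ?_
    calc O.valuation π ^ n * O.valuation (g₀ - f₁ ^ p)
        ≤ O.valuation π ^ n * (O.valuation π * O.valuation (g₀ - f₀ ^ p)) := mul_le_mul_right (hstep _ _ hlt) _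
      _ = O.valuation π ^ μ f₀ * O.valuation (g₀ - f₀ ^ p) := by rw [hn, pow_succ, mul_assoc]
      _ ≤ O.valuation b := hμ f₀
  omega

end Summit.ResolutionOfSingularities.ResolutionOfSingularities.Theorems.RadicialJung.CleanModels

end
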